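import Summits.Ventures.HSemireg.CocycleExtensionComplex
import HarnessLib

/-!
# Venture HSemireg — comparison of two extensions differing by a local `1`-cocycle, MODULE LEVEL (gs-g4 gen 21,
# brick C4c of `general-structure/COMPLEX-LEIBNIZ-PLAN-gs-g4.md`)

HONEST FRAMING. Sheaf algebra on an arbitrary scheme `X` with a unit `1`-cocycle `c` (only its cover is used),
continuing `CocycleExtension*.lean`. Nothing about any variety; nothing here says HC, HC_CM or HC_AV is proved.

## Setting and contents (everything proved)

Two extensions `B →ι₁ M₁ →π₁ A`, `B →ι₂ M₂ →π₂ A` of `A` by `B`, a local `1`-cocycle `w = (w_{xy} : A|_V → B|_V)`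
and local morphisms `φ_x : M₁|_{U_x} → M₂|_{U_x}` compatible with the `ι`'s and `π`'s whose differences on overlaps
are the cocycle: `φ_y| - φ_x| = π₁| ≫ w_{xy} ≫ ι₂|`. The MIDDLE OBJECT of the comparison is the cocycle extension
`Y = ext w̃` of `M₁` by `B` along the pulled-back cocycle `w̃ = (π₁| ≫ w_{xy})`:

* `ψLoc x = π_Y| ≫ φ_x + ret_x ≫ ι₂| : Y|_{U_x} → M₂|_{U_x}`; these agree on overlaps (`ψLoc_compatible`) and glue to
  **`ψ : Y ⟶ M₂`** (`restrict_ψ`, `ι_ψ : ι_Y ≫ ψ = ι₂`, `ψ_π : ψ ≫ π₂ = π_Y ≫ π₁`);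
* `χ = map w̃ w π₁ 𝟙 : Y ⟶ ext w` and `incl = map 0 w̃ ι₁ 𝟙 : K ⟶ Y` from the split extension `K = ext 0` of `B`
  by `B`; the three "first components" of the morphisms of extensions out of `0 → K → Y → A → 0`:
  `incl_πY : incl ≫ π_Y = π_K ≫ ι₁`, `incl_χ : incl ≫ χ = ρ ≫ ι_{ext w}`, **`incl_ψ : incl ≫ ψ = (π_K + ρ) ≫ ι₂`**;
* `shortExact_KYA` — `0 → K → Y → A → 0` is short exact when `B → M₁ → A` is.

The derived consequence `δ(M₂) = δ(M₁) + δ(ext w)` for complexes is drawn in the sequel.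

## References

* [Har77] R. Hartshorne, *Algebraic Geometry*, GTM 52 (1977), II Ex. 1.22, III.4; III Ex. 4.5 (Baer sum via cocycles).
-/

noncomputable section

set_option backward.isDefEq.respectTransparency false

open CategoryTheory CategoryTheory.Limits AlgebraicGeometry TopologicalSpace Opposite

namespace Summit.Ventures.HSemireg

open Literature.AlgebraicGeometry.Modules Literature.AlgebraicGeometry.HodgeTheory CocycleTwist

universe u

variable {X : Scheme.{u}} {c : UnitCocycle X}

/-- `restrictHom` commutes with subtraction (any scheme). [folklore] -/
theorem restrictHom_sub'' {E M : X.Modules} {U V : X.Opens} (i : V ⟶ U) (φ ψ : E.over U ⟶ M.over U) :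
    restrictHom i (φ - ψ) = restrictHom i φ - restrictHom i ψ :=
  hom_ext_of_appLE fun W k s => by rw [appLE_restrictHom, appLE_sub_left, appLE_sub_left, appLE_restrictHom, appLE_restrictHom]

/-- `(f + g)|_V = f|_V + g|_V`. [folklore] -/
theorem over_map_add {E M : X.Modules} (V : X.Opens) (f g : E ⟶ M) :
    (SheafOfModules.overFunctor _ V).map (f + g) =
      (SheafOfModules.overFunctor _ V).map f + (SheafOfModules.overFunctor _ V).map g :=
  hom_ext_of_appLE fun W k s => by
    rw [appLE_add, appLE_over_map, appLE_over_map, appLE_over_map, Scheme.Modules.Hom.add_app]; rfl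

/-- Restricting a morphism descended from the covering open `⨆ U_x` back to `U_x`. [folklore] -/
theorem over_map_homOfOverCover {E M : X.Modules} (Φ : E.over (iSup c.U) ⟶ M.over (iSup c.U)) (x : X) :
    (SheafOfModules.overFunctor _ (c.U x)).map (homOfOverCover c.mem Φ) = restrictHom (Opens.leSupr c.U x) Φ :=
  hom_ext_of_appLE fun W k s => by
    rw [appLE_over_map, homOfOverCover_app, appLE_restrictHom]
    exact appLE_congr_hom _ _ _ _

namespace ExtensionCompare

variable {A B M₁ M₂ : X.Modules} (ι₁ : B ⟶ M₁) (π₁ : M₁ ⟶ A) (ι₂ : B ⟶ M₂) (π₂ : M₂ ⟶ A)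
  (w : LocalOneCocycle c A B) (φ : ∀ x : X, M₁.over (c.U x) ⟶ M₂.over (c.U x))

/-! ### The glued comparison map `ψ : ext w̃ ⟶ M₂` -/

/-- **`ψ_x = π_Y| ≫ φ_x + ret_x ≫ ι₂|`** on `Y = ext w̃`, `w̃ = (π₁| ≫ w_{xy})`. [folklore] -/
def ψLoc (x : X) : (CocycleExtension.ext (w.precomp π₁)).over (c.U x) ⟶ M₂.over (c.U x) :=
  (SheafOfModules.overFunctor _ (c.U x)).map (CocycleExtension.π (w.precomp π₁)) ≫ φ x +
    CocycleExtension.ret (w.precomp π₁) x ≫ (SheafOfModules.overFunctor _ (c.U x)).map ι₂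

variable (hφ : ∀ (x y : X) (V : X.Opens) (hx : V ≤ c.U x) (hy : V ≤ c.U y),
  restrictHom (homOfLE hy) (φ y) - restrictHom (homOfLE hx) (φ x) =
    (SheafOfModules.overFunctor _ V).map π₁ ≫ w.w x y V hx hy ≫ (SheafOfModules.overFunctor _ V).map ι₂)

include hφ in
/-- Values of `ψ_x - ψ_y` vanish on `W ⊆ U_x ∩ U_y`: `(φ_x - φ_y)(m)` and `ι₂(β_x - β_y) = ι₂ w_{xy}(π₁ m)` cancel.
[folklore] -/
theorem appLE_ψLoc_eq {W : X.Opens} (x y : X) (kx : W ⟶ c.U x) (ky : W ⟶ c.U y)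
    (s : Γ(CocycleExtension.ext (w.precomp π₁), W)) :
    appLE (ψLoc π₁ ι₂ w φ x) kx s = appLE (ψLoc π₁ ι₂ w φ y) ky s := by
  rw [ψLoc, ψLoc, appLE_add, appLE_add, appLE_comp, appLE_comp, appLE_comp, appLE_comp, appLE_over_map,
    appLE_over_map, appLE_over_map, appLE_over_map, CocycleExtension.π_app_apply, CocycleExtension.appLE_ret,
    CocycleExtension.appLE_ret]
  -- the two relations
  have h1 := congrArg (fun θ => appLE θ (𝟙 W) (CocycleExtension.fst (w.precomp π₁) s)) (hφ x y W kx.le ky.le)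
  simp only [appLE_sub_left, appLE_restrictHom, appLE_comp, appLE_over_map] at h1
  rw [appLE_congr_hom (φ y) (𝟙 W ≫ homOfLE ky.le) ky, appLE_congr_hom (φ x) (𝟙 W ≫ homOfLE kx.le) kx] at h1
  have h2 := CocycleExtension.comp_rel (w.precomp π₁) s x y (W := W) le_rfl kx.le ky.le
  rw [LocalOneCocycle.precomp_w, appLE_comp, appLE_over_map,
    Subsingleton.elim (homOfLE (le_refl W)).op (𝟙 (op W)), CategoryTheory.Functor.map_id] at h2
  change _ = appLE _ _ (π₁.app W (CocycleExtension.fst (w.precomp π₁) s)) at h2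
  rw [← sub_eq_zero]
  have e : appLE (φ x) kx (CocycleExtension.fst (w.precomp π₁) s) +
        ι₂.app W ((B.presheaf.map (homOfLE (le_inf le_rfl kx.le)).op) (CocycleExtension.comp (w.precomp π₁) s x)) -
      (appLE (φ y) ky (CocycleExtension.fst (w.precomp π₁) s) +
        ι₂.app W ((B.presheaf.map (homOfLE (le_inf le_rfl ky.le)).op) (CocycleExtension.comp (w.precomp π₁) s y))) =
      -(appLE (φ y) ky (CocycleExtension.fst (w.precomp π₁) s) - appLE (φ x) kx (CocycleExtension.fst (w.precomp π₁) s)) +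
        ι₂.app W ((B.presheaf.map (homOfLE (le_inf le_rfl kx.le)).op) (CocycleExtension.comp (w.precomp π₁) s x) -
          (B.presheaf.map (homOfLE (le_inf le_rfl ky.le)).op) (CocycleExtension.comp (w.precomp π₁) s y)) := by
    rw [map_sub]; abel
  rw [e, h1, h2, neg_add_eq_zero]

include hφ in
/-- The `ψ_x` agree on overlaps. [folklore] -/
theorem ψLoc_compatible (x y : X) :
    restrictHom (Opens.infLELeft (c.U x) (c.U y)) (ψLoc π₁ ι₂ w φ x) =
      restrictHom (Opens.infLERight (c.U x) (c.U y)) (ψLoc π₁ ι₂ w φ y) :=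
  hom_ext_of_appLE fun W k s => by
    rw [appLE_restrictHom, appLE_restrictHom]
    exact appLE_ψLoc_eq π₁ ι₂ w φ hφ x y _ _ s

/-- **The comparison map `ψ : Y = ext w̃ ⟶ M₂`**, glued from the `ψ_x` (`Modules/SheafHom.glueHom` over the cover,
descended by `homOfOverCover`). [cite: Hartshorne1977, II Ex. 1.22] -/
def ψ : CocycleExtension.ext (w.precomp π₁) ⟶ M₂ :=
  homOfOverCover c.mem (glueHom c.U (ψLoc π₁ ι₂ w φ) (ψLoc_compatible π₁ ι₂ w φ hφ))

/-- **`ψ|_{U_x} = ψ_x`.** [folklore] -/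
theorem restrict_ψ (x : X) :
    (SheafOfModules.overFunctor _ (c.U x)).map (ψ π₁ ι₂ w φ hφ) = ψLoc π₁ ι₂ w φ x := by
  rw [ψ, over_map_homOfOverCover, restrictHom_glueHom]

variable (hφι : ∀ x : X, (SheafOfModules.overFunctor _ (c.U x)).map ι₁ ≫ φ x = (SheafOfModules.overFunctor _ _).map ι₂)
  (hφπ : ∀ x : X, φ x ≫ (SheafOfModules.overFunctor _ (c.U x)).map π₂ = (SheafOfModules.overFunctor _ _).map π₁)

/-- **`ι_Y ≫ ψ = ι₂`** (over `U_x`: `ι_Y ≫ π_Y = 0` and `ι_Y| ≫ ret_x = 𝟙`). [folklore] -/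
theorem ι_ψ : CocycleExtension.ι (w.precomp π₁) ≫ ψ π₁ ι₂ w φ hφ = ι₂ := by
  refine hom_ext_of_cover c fun x => ?_
  rw [Functor.map_comp, restrict_ψ, ψLoc, Preadditive.comp_add, ← Category.assoc, ← Functor.map_comp,
    CocycleExtension.ι_comp_π, ← Category.assoc, CocycleExtension.ι_comp_ret, Category.id_comp]
  have h0 : (SheafOfModules.overFunctor _ (c.U x)).map (0 : B ⟶ M₁) = 0 :=
    hom_ext_of_appLE fun W k s => by rw [appLE_over_map, appLE_zero, Scheme.Modules.Hom.zero_app]; rfl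
  rw [h0, zero_comp, zero_add]

include hφπ in
/-- **`ψ ≫ π₂ = π_Y ≫ π₁`** (over `U_x`: `φ_x ≫ π₂| = π₁|` and `ι₂ ≫ π₂ = 0`). [folklore] -/
theorem ψ_π (h₂ : ι₂ ≫ π₂ = 0) : ψ π₁ ι₂ w φ hφ ≫ π₂ = CocycleExtension.π (w.precomp π₁) ≫ π₁ := by
  refine hom_ext_of_cover c fun x => ?_
  rw [Functor.map_comp, Functor.map_comp, restrict_ψ, ψLoc, Preadditive.add_comp, Category.assoc, hφπ,
    Category.assoc, ← (SheafOfModules.overFunctor _ (c.U x)).map_comp ι₂ π₂, h₂]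
  have h0 : (SheafOfModules.overFunctor _ (c.U x)).map (0 : B ⟶ A) = 0 :=
    hom_ext_of_appLE fun W k s => by rw [appLE_over_map, appLE_zero, Scheme.Modules.Hom.zero_app]; rfl
  rw [h0, Limits.comp_zero, add_zero]

/-! ### The maps out of the split kernel `K = ext 0` and the middle object `Y` -/

/-- Compatibility for `incl = map 0 w̃ ι₁ 𝟙` (needs `ι₁ ≫ π₁ = 0`). [folklore] -/
theorem incl_compat (h₁ : ι₁ ≫ π₁ = 0) (x y : X) (V : X.Opens) (hx : V ≤ c.U x) (hy : V ≤ c.U y) :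
    (SheafOfModules.overFunctor _ V).map ι₁ ≫ (w.precomp π₁).w x y V hx hy =
      (0 : LocalOneCocycle c B B).w x y V hx hy ≫ (SheafOfModules.overFunctor _ V).map (𝟙 B) := by
  rw [LocalOneCocycle.precomp_w, ← Category.assoc, ← Functor.map_comp, h₁, LocalOneCocycle.zero_w, zero_comp]
  have h0 : (SheafOfModules.overFunctor _ V).map (0 : B ⟶ A) = 0 :=
    hom_ext_of_appLE fun W k s => by rw [appLE_over_map, appLE_zero, Scheme.Modules.Hom.zero_app]; rfl
  rw [h0, zero_comp]

/-- Compatibility for `χ = map w̃ w π₁ 𝟙`. [folklore] -/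
theorem χ_compat (x y : X) (V : X.Opens) (hx : V ≤ c.U x) (hy : V ≤ c.U y) :
    (SheafOfModules.overFunctor _ V).map π₁ ≫ w.w x y V hx hy =
      (w.precomp π₁).w x y V hx hy ≫ (SheafOfModules.overFunctor _ V).map (𝟙 B) := by
  rw [LocalOneCocycle.precomp_w, CategoryTheory.Functor.map_id, Category.comp_id]

/-- Compatibility for `(0, 𝟙) : (B, B, 0) → (A, B, w)`. [folklore] -/
theorem zero_one_compat (x y : X) (V : X.Opens) (hx : V ≤ c.U x) (hy : V ≤ c.U y) :
    (SheafOfModules.overFunctor _ V).map (0 : B ⟶ A) ≫ w.w x y V hx hy =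
      (0 : LocalOneCocycle c B B).w x y V hx hy ≫ (SheafOfModules.overFunctor _ V).map (𝟙 B) := by
  have h0 : (SheafOfModules.overFunctor _ V).map (0 : B ⟶ A) = 0 :=
    hom_ext_of_appLE fun W k s => by rw [appLE_over_map, appLE_zero, Scheme.Modules.Hom.zero_app]; rfl
  rw [h0, zero_comp, LocalOneCocycle.zero_w, zero_comp]

/-- **`incl : K = ext 0 ⟶ Y`**, `(b′, β) ↦ (ι₁ b′, β)`. [folklore] -/
def incl (h₁ : ι₁ ≫ π₁ = 0) : CocycleExtension.ext (0 : LocalOneCocycle c B B) ⟶ CocycleExtension.ext (w.precomp π₁) :=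
  CocycleExtension.map 0 (w.precomp π₁) ι₁ (𝟙 B) (incl_compat ι₁ π₁ w h₁)

/-- **`χ : Y ⟶ ext w`**, `(m, β) ↦ (π₁ m, β)`. [folklore] -/
def χ : CocycleExtension.ext (w.precomp π₁) ⟶ CocycleExtension.ext w :=
  CocycleExtension.map (w.precomp π₁) w π₁ (𝟙 B) (χ_compat π₁ w)

/-- **First component towards `M₁`: `incl ≫ π_Y = π_K ≫ ι₁`.** [folklore] -/
theorem incl_πY (h₁ : ι₁ ≫ π₁ = 0) :
    incl ι₁ π₁ w h₁ ≫ CocycleExtension.π (w.precomp π₁) = CocycleExtension.π (0 : LocalOneCocycle c B B) ≫ ι₁ := by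
  rw [incl]
  exact CocycleExtension.map_π _ _ _ _ _

/-- **First component towards `ext w`: `incl ≫ χ = ρ ≫ ι`.** [folklore] -/
theorem incl_χ (h₁ : ι₁ ≫ π₁ = 0) :
    incl ι₁ π₁ w h₁ ≫ χ π₁ w = CocycleExtension.ρ B B ≫ CocycleExtension.ι w := by
  rw [incl, χ, CocycleExtension.map_comp _ _ _ _ _ _ _ _ _
    (CocycleExtension.compat_comp _ _ _ (incl_compat ι₁ π₁ w h₁) (χ_compat π₁ w)),
    CocycleExtension.map_congr _ _ h₁ (Category.comp_id _) _ (zero_one_compat w), CocycleExtension.map_zero_left,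
    Category.id_comp]

include hφι in
/-- **First component towards `M₂`: `incl ≫ ψ = (π_K + ρ) ≫ ι₂`** (over `U_x`: `map| ≫ ret^Y_x = ret^K_x`,
`ι₁| ≫ φ_x = ι₂|`, `ρ|_{U_x} = ret^K_x`). [folklore] -/
theorem incl_ψ (h₁ : ι₁ ≫ π₁ = 0) :
    incl ι₁ π₁ w h₁ ≫ ψ π₁ ι₂ w φ hφ =
      (CocycleExtension.π (0 : LocalOneCocycle c B B) + CocycleExtension.ρ B B) ≫ ι₂ := by
  refine hom_ext_of_cover c fun x => ?_
  rw [Functor.map_comp, restrict_ψ, ψLoc, Preadditive.comp_add, ← Category.assoc, ← Functor.map_comp, incl_πY, incl,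
    Functor.map_comp, Category.assoc, hφι, ← Category.assoc, CocycleExtension.map_ret, Category.assoc,
    CategoryTheory.Functor.map_id, Category.id_comp, Functor.map_comp, over_map_add, Preadditive.add_comp,
    CocycleExtension.restrictHom_ρ]

/-! ### `0 → K → Y → A → 0` is short exact -/

/-- `incl ≫ (π_Y ≫ π₁) = 0`. [folklore] -/
theorem incl_πY_π₁ (h₁ : ι₁ ≫ π₁ = 0) :
    incl ι₁ π₁ w h₁ ≫ CocycleExtension.π (w.precomp π₁) ≫ π₁ = 0 := by
  rw [← Category.assoc, incl_πY, Category.assoc, h₁, Limits.comp_zero]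

/-- A section of `Y` whose `M₁`-part is `ι₁ b′` comes from `K`: its point family has zero differences. [folklore] -/
theorem liftFamily_mem {V : X.Opens} (s : Γ(CocycleExtension.ext (w.precomp π₁), V)) (b' : Γ(B, V))
    (hb : ι₁.app V b' = CocycleExtension.fst (w.precomp π₁) s) (h₁ : ι₁ ≫ π₁ = 0) :
    ((b', fun x => CocycleExtension.comp (w.precomp π₁) s x) : CocycleExtension.PairFamily V) ∈
      CocycleExtension.extFamilies (0 : LocalOneCocycle c B B) V := by
  intro x y W hW hx hy
  have h := CocycleExtension.comp_rel (w.precomp π₁) s x y hW hx hy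
  rw [LocalOneCocycle.precomp_w, appLE_comp, appLE_over_map, ← hb, app_map_apply, ← CategoryTheory.comp_apply,
    ← Scheme.Modules.Hom.comp_app, h₁, Scheme.Modules.Hom.zero_app] at h
  rw [h, LocalOneCocycle.zero_w, appLE_zero]
  exact appLE_zero_right _ _

/-- **`0 → K →incl Y →(π_Y ≫ π₁) A → 0` is short exact** when `0 → B → M₁ → A → 0` is. [folklore] -/
theorem shortExact_KYA (h₁ : ι₁ ≫ π₁ = 0) (hS₁ : (ShortComplex.mk ι₁ π₁ h₁).ShortExact) :
    (ShortComplex.mk (incl ι₁ π₁ w h₁) (CocycleExtension.π (w.precomp π₁) ≫ π₁) (incl_πY_π₁ ι₁ π₁ w h₁)).ShortExact where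
  exact := by
    refine exact_of_locally_exact _ fun V s hs v hv => ⟨V, 𝟙 V, hv, ?_⟩
    have hs' : π₁.app V (CocycleExtension.fst (w.precomp π₁) s) = 0 := hs
    obtain ⟨b', hb'⟩ := (sections_exact_of_shortExact hS₁ V).2 _ hs'
    refine ⟨CocycleExtension.mk 0 _ (liftFamily_mem ι₁ π₁ w s b' hb' h₁), ?_⟩
    change (incl ι₁ π₁ w h₁).app V _ = (CocycleExtension.ext (w.precomp π₁)).presheaf.map (𝟙 V).op s
    rw [presheaf_map_id_apply]
    exact CocycleExtension.ext_ext _ (by rw [incl, CocycleExtension.fst_map_app, CocycleExtension.fst_mk, hb'])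
      fun x => by rw [incl, CocycleExtension.comp_map_app, CocycleExtension.comp_mk]; rfl
  mono_f := by
    change Mono (incl ι₁ π₁ w h₁)
    have hinj : ∀ V : X.Opens, Function.Injective ((incl ι₁ π₁ w h₁).app V) := fun V k k' hk => by
      refine CocycleExtension.ext_ext _ ?_ fun x => ?_
      · have h := congrArg (CocycleExtension.fst (w.precomp π₁)) hk
        rw [incl, CocycleExtension.fst_map_app, CocycleExtension.fst_map_app] at h
        exact (sections_exact_of_shortExact hS₁ V).1 h
      · have h := congrArg (fun s => CocycleExtension.comp (w.precomp π₁) s x) hk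
        simp only [incl, CocycleExtension.comp_map_app] at h
        exact h
    haveI : ∀ U, Mono ((incl ι₁ π₁ w h₁).mapPresheaf.app U) := fun U =>
      ConcreteCategory.mono_of_injective _ (hinj U.unop)
    haveI : Mono (incl ι₁ π₁ w h₁).mapPresheaf := NatTrans.mono_of_mono_app _
    exact (Scheme.Modules.toPresheaf X).mono_of_mono_map this
  epi_g := by
    haveI := hS₁.epi_g
    haveI := (CocycleExtension.shortExact (w.precomp π₁)).epi_g
    exact epi_comp (CocycleExtension.π (w.precomp π₁)) π₁

end ExtensionCompare

end Summit.Ventures.HSemireg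

end
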